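import Mathlib.RingTheory.AlgebraicIndependent.Transcendental
import Mathlib.RingTheory.AlgebraicIndependent.TranscendenceBasis
import Mathlib.RingTheory.Algebraic.Integral
import Mathlib.Algebra.MvPolynomial.Funext
import Mathlib.Algebra.Polynomial.Roots
import HarnessLib

/-!
# Generic linear forms in elements of a field extension are algebraically independent

`Literature/RingTheory/NoetherNormalization/GenericLinearForms.lean` — proofs only (no
definitions, nothing asserted). The algebraic content of the classical facts "a generic linear
subspace of codimension `s ≤ dim V` cuts the irreducible variety `V` in dimension `dim V − s`"
and "the projection of `V` from a generic centre is generically finite onto its image"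
(van der Waerden, *Einführung in die algebraische Geometrie*, §§29–31; Hodge–Pedoe,
*Methods of Algebraic Geometry* II, Ch. X §6; Zariski–Samuel II, Ch. VII §7), in the form needed
for the theory of Chow forms (Nesterenko's elimination theory, LNM 1752 Ch. 3 §4 / [Nes10] §1,
Prop. 4.4: the elimination ideal of a prime ideal of dimension `r − 1` with respect to `r`
generic linear forms is a *principal* prime ideal):

* `algebraicIndependent_sumElim_genericLinearForms` — **generic linear forms are algebraically
  independent.** Let `K ⊆ F ⊆ Ω` be fields with `K` infinite, `y : ι → F` finitely many
  elements generating over `K` a subalgebra of transcendence degree `≥ s`, and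
  `u = (u_{ik})_{i<s, k∈ι}` elements of `Ω` algebraically independent over `F`. Then the family
  consisting of all `u_{ik}` and of the `s` linear combinations `wᵢ = ∑ₖ yₖ u_{ik}` is
  algebraically independent over `K`; i.e. `w₁, …, w_s` are algebraically independent over
  `K(u)`.

The proof is elementary and characteristic-free (for infinite `K`): if `P(u, w) = 0`, the
algebraic independence of `u` over `F` allows the specialisation `u_{ik} ↦ c_{ik} tᵢ`
(`c ∈ K^{s×ι}`, `tᵢ` indeterminates), under which `wᵢ ↦ tᵢ zᵢ(c)` with
`zᵢ(c) = ∑ₖ c_{ik} yₖ ∈ F`; whenever `z₁(c), …, z_s(c)` are algebraically independent over `K`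
this forces the polynomial `P(c_{ik} Tᵢ ; Tᵢ Zᵢ) ∈ K[T, Z]` to vanish
(`aeval_genericSpec_eq_zero`); and the `c` for which they are dependent are met at most once
on suitable lines of `K^{s×ι}`, taken row by row (`subsingleton_setOf_not_algebraicIndependent_cons`,
using a `yₖ` transcendental over `K[z₂(c), …]`, which exists as long as `s ≤ trdeg`), so that a
polynomial over the infinite field `K` vanishing at all good `c` vanishes identically
(`eq_zero_of_forall_algebraicIndependent_aeval_eq_zero`); finally the universal specialisation
`U_{ik} ↦ C_{ik} Tᵢ, Wᵢ ↦ Tᵢ Zᵢ` is injective (it has the left inverse `Tᵢ ↦ 1`).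

Tools on transcendence degrees of generated subalgebras `K[S] = Algebra.adjoin K S` of a field,
proved on the way and used by the Chow-form files: `trdeg_adjoin_le_of_forall_isAlgebraic`
(`trdeg K[s] ≤ #t` if `s` is algebraic over `K[t]`), `trdeg_adjoin_union_le`
(`trdeg K[s ∪ t] ≤ trdeg K[s] + #t`), `exists_transcendental_adjoin_of_lt_trdeg`,
`trdeg_adjoin_range_le_card`, `lift_trdeg_adjoin_image_eq`.

## References

* B. L. van der Waerden, *Einführung in die algebraische Geometrie*, Springer 1939/1973,
  §§29–31 (allgemeine Punkte, lineare Schnitte).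
* W. V. D. Hodge, D. Pedoe, *Methods of Algebraic Geometry*, vol. II, CUP 1952, Ch. X §6–§8
  (generic linear sections; Cayley forms).
* [NesterenkoPhilippon2001] Yu. V. Nesterenko, P. Philippon (eds.), *Introduction to Algebraic
  Independence Theory*, LNM 1752, Springer 2001, Ch. 3 §4 Prop. 4.4 (p. 38).
-/

noncomputable section

open MvPolynomial Cardinal

universe u v w

namespace Literature.RingTheory.NoetherNormalization

variable {K : Type*} [Field K]

/-! ### Two density lemmas over an infinite field -/

/-- A polynomial `G(a̲, t̲)` over an infinite field whose partial evaluations `G(v, t̲)` at all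
`v ∈ K^α` vanish is zero. [folklore] -/
theorem eq_zero_of_forall_aeval_sumElim_C_eq_zero [Infinite K] {α τ : Type*}
    {G : MvPolynomial (α ⊕ τ) K}
    (h : ∀ v : α → K,
      aeval (Sum.elim (fun a => C (v a)) X : α ⊕ τ → MvPolynomial τ K) G = 0) :
    G = 0 := by
  apply MvPolynomial.funext
  intro x
  have hcomp : (aeval (R := K) (x ∘ Sum.inr)).comp
      (aeval (Sum.elim (fun a => C (x (Sum.inl a))) X : α ⊕ τ → MvPolynomial τ K)) =
      aeval x := by
    refine MvPolynomial.algHom_ext fun i => ?_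
    rcases i with a | t <;> simp
  have key : aeval x G = 0 := by
    rw [← hcomp, AlgHom.comp_apply, h, map_zero]
  rw [map_zero, ← coe_aeval_eq_eval]
  exact key

/-- If the partial evaluations `G(c + t d, t̲)` of a polynomial `G(a̲, t̲)` over an infinite field
vanish for infinitely many `t ∈ K` on a line `c + K d ⊆ K^α`, then they vanish at `c`. [folklore] -/
theorem aeval_sumElim_C_eq_zero_of_infinite [Infinite K] {α τ : Type*}
    (G : MvPolynomial (α ⊕ τ) K) (c d : α → K)
    (h : Set.Infinite {t : K |
      aeval (Sum.elim (fun a => C (c a + t * d a)) X : α ⊕ τ → MvPolynomial τ K) G = 0}) :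
    aeval (Sum.elim (fun a => C (c a)) X : α ⊕ τ → MvPolynomial τ K) G = 0 := by
  -- the one-variable polynomial `t ↦ G(c + t d, t̲)`
  set H : Polynomial (MvPolynomial τ K) :=
    aeval (Sum.elim (fun a => Polynomial.C (C (c a)) + Polynomial.X * Polynomial.C (C (d a)))
      (fun i => Polynomial.C (X i)) : α ⊕ τ → Polynomial (MvPolynomial τ K)) G with hH
  have hev : ∀ t : K, H.eval (C t) =
      aeval (Sum.elim (fun a => C (c a + t * d a)) X : α ⊕ τ → MvPolynomial τ K) G := by
    intro t
    have hcomp : ((Polynomial.aeval (R := MvPolynomial τ K) (C t : MvPolynomial τ K)).restrictScalars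
        K).comp (aeval (Sum.elim (fun a => Polynomial.C (C (c a)) + Polynomial.X *
          Polynomial.C (C (d a))) (fun i => Polynomial.C (X i)) :
            α ⊕ τ → Polynomial (MvPolynomial τ K))) =
        aeval (Sum.elim (fun a => C (c a + t * d a)) X : α ⊕ τ → MvPolynomial τ K) := by
      refine MvPolynomial.algHom_ext fun i => ?_
      rcases i with a | i
      · simp only [AlgHom.coe_comp, AlgHom.coe_restrictScalars', Function.comp_apply, aeval_X,
          Sum.elim_inl, map_add, map_mul, Polynomial.aeval_C, Polynomial.aeval_X]
        simp
      · simp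
    rw [← hcomp, hH]
    simp [Polynomial.coe_aeval_eq_eval]
  have hH0 : H = 0 := by
    apply Polynomial.eq_zero_of_infinite_isRoot
    refine Set.Infinite.mono (s := (C : K → MvPolynomial τ K) '' {t : K |
      aeval (Sum.elim (fun a => C (c a + t * d a)) X : α ⊕ τ → MvPolynomial τ K) G = 0}) ?_
      (h.image (C_injective τ K).injOn)
    rintro _ ⟨t, ht, rfl⟩
    simp only [Set.mem_setOf_eq, Polynomial.IsRoot.def, hev t]
    exact ht
  have := hev 0
  rw [hH0, Polynomial.eval_zero] at this
  simpa using this.symm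

/-! ### The specialisation `u_{ik} ↦ c_{ik} tᵢ`, `wᵢ ↦ tᵢ zᵢ` -/

section Spec

variable {F Ω : Type*} [Field F] [Field Ω] [Algebra K F] [Algebra F Ω] [Algebra K Ω]
  [IsScalarTower K F Ω] {ι : Type*} [Fintype ι] {s : ℕ}

/-- **Specialisation.** Let `u = (u_{ik})` be algebraically independent over `F` and
`wᵢ = ∑ₖ yₖ u_{ik}` with `yₖ ∈ F`. If a polynomial `P(U, W)` over `K` vanishes at `(u, w)`, then
for every `c ∈ K^{s × ι}` such that the elements `zᵢ = ∑ₖ c_{ik} yₖ` of `F` are algebraically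
independent over `K`, the polynomial `P(c_{ik} Tᵢ ; Tᵢ Zᵢ) ∈ K[T, Z]` is zero (substitute
`u_{ik} ↦ c_{ik} Tᵢ`, which is legitimate by the independence of `u`, and use the independence of
`T, z` to lift from `F[T]` to `K[T, Z]`). [folklore] -/
theorem aeval_genericSpec_eq_zero (y : ι → F) (u : Fin s × ι → Ω) (hu : AlgebraicIndependent F u)
    {P : MvPolynomial ((Fin s × ι) ⊕ Fin s) K}
    (hP : aeval (Sum.elim u (fun i => ∑ k, algebraMap F Ω (y k) * u (i, k))) P = 0)
    (c : Fin s × ι → K)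
    (hc : AlgebraicIndependent K (fun i : Fin s => ∑ k, algebraMap K F (c (i, k)) * y k)) :
    aeval (Sum.elim (fun p => C (c p)) X :
        (Fin s × ι) ⊕ (Fin s ⊕ Fin s) → MvPolynomial (Fin s ⊕ Fin s) K)
      (aeval (Sum.elim (fun p : Fin s × ι => X (Sum.inl p) * X (Sum.inr (Sum.inl p.1)))
          (fun i : Fin s => X (Sum.inr (Sum.inl i)) * X (Sum.inr (Sum.inr i))) :
        (Fin s × ι) ⊕ Fin s → MvPolynomial ((Fin s × ι) ⊕ (Fin s ⊕ Fin s)) K) P) = 0 := by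
  -- `σ`: substitute the linear forms for the `Wᵢ`, over `F`
  set σ : MvPolynomial ((Fin s × ι) ⊕ Fin s) K →ₐ[K] MvPolynomial (Fin s × ι) F :=
    aeval (Sum.elim X (fun i => ∑ k, C (y k) * X (i, k))) with hσ
  have hσP : σ P = 0 := by
    have hcomp : ((aeval u).restrictScalars K).comp σ =
        aeval (Sum.elim u (fun i => ∑ k, algebraMap F Ω (y k) * u (i, k))) := by
      refine MvPolynomial.algHom_ext fun v => ?_
      rcases v with p | i
      · simp [σ]
      · simp [σ, map_sum]
    have h1 : aeval u (σ P) = 0 := by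
      have := congrArg (fun f => f P) hcomp
      simpa [hP] using this
    have hinj : Function.Injective (aeval u : MvPolynomial (Fin s × ι) F →ₐ[F] Ω) := hu
    exact (injective_iff_map_eq_zero _).1 hinj (σ P) h1
  -- the specialisation maps
  set η : MvPolynomial ((Fin s × ι) ⊕ Fin s) K →ₐ[K]
      MvPolynomial ((Fin s × ι) ⊕ (Fin s ⊕ Fin s)) K :=
    aeval (Sum.elim (fun p : Fin s × ι => X (Sum.inl p) * X (Sum.inr (Sum.inl p.1)))
      (fun i : Fin s => X (Sum.inr (Sum.inl i)) * X (Sum.inr (Sum.inr i)))) with hη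
  set ev : MvPolynomial ((Fin s × ι) ⊕ (Fin s ⊕ Fin s)) K →ₐ[K] MvPolynomial (Fin s ⊕ Fin s) K :=
    aeval (Sum.elim (fun p => C (c p)) X) with hev
  set z : Fin s → F := fun i => ∑ k, algebraMap K F (c (i, k)) * y k with hz
  set ρ : MvPolynomial (Fin s ⊕ Fin s) K →ₐ[K] MvPolynomial (Fin s) F :=
    aeval (Sum.elim X (fun i => C (z i))) with hρ
  set τ : MvPolynomial (Fin s × ι) F →ₐ[F] MvPolynomial (Fin s) F :=
    aeval (fun p => C (algebraMap K F (c p)) * X p.1) with hτ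
  have hcomp : (ρ.comp ev).comp η = (τ.restrictScalars K).comp σ := by
    refine MvPolynomial.algHom_ext fun v => ?_
    rcases v with ⟨i, k⟩ | i
    · simp [η, ev, ρ, τ, σ]
    · simp only [η, ev, ρ, τ, σ, z, AlgHom.coe_comp, Function.comp_apply, aeval_X, Sum.elim_inr,
        map_mul, Sum.elim_inl, map_sum, AlgHom.coe_restrictScalars', Finset.mul_sum]
      refine Finset.sum_congr rfl fun k _ => ?_
      simp only [aeval_C, algebraMap_eq]
      ring
  have hρinj : Function.Injective ρ := by
    have hind : AlgebraicIndependent K (Sum.elim (X : Fin s → MvPolynomial (Fin s) F)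
        (algebraMap F (MvPolynomial (Fin s) F) ∘ z)) :=
      hc.sumElim_comp (MvPolynomial.algebraicIndependent_X (Fin s) F)
    have heq : (aeval (Sum.elim (X : Fin s → MvPolynomial (Fin s) F)
        (algebraMap F (MvPolynomial (Fin s) F) ∘ z)) : _ →ₐ[K] MvPolynomial (Fin s) F) = ρ := by
      refine MvPolynomial.algHom_ext fun v => ?_
      rcases v with i | i <;> simp [ρ]
    have : Function.Injective (aeval (Sum.elim (X : Fin s → MvPolynomial (Fin s) F)
        (algebraMap F (MvPolynomial (Fin s) F) ∘ z)) : _ →ₐ[K] MvPolynomial (Fin s) F) := hind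
    rwa [heq] at this
  show ev (η P) = 0
  apply hρinj
  have := congrArg (fun f => f P) hcomp
  simp only [AlgHom.comp_apply, AlgHom.coe_restrictScalars'] at this
  rw [map_zero, this, hσP, map_zero]

end Spec

/-! ### Transcendence degree of generated subalgebras -/

section Trdeg

variable {F : Type*} [Field F] [Algebra K F]

/-- For a `K`-subalgebra `A` of `F` and `t ⊆ A`, the subalgebra of `A` generated by `t` maps
isomorphically onto the subalgebra of `F` generated by `t`. [folklore] -/
theorem exists_algEquiv_adjoin_preimage (A : Subalgebra K F) {t : Set F} (ht : t ⊆ A) :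
    ∃ e : Algebra.adjoin K (((↑) : A → F) ⁻¹' t) ≃ₐ[K] Algebra.adjoin K t,
      ∀ x, ((e x : F)) = ((x : A) : F) := by
  set t' : Set A := ((↑) : A → F) ⁻¹' t with ht'
  have hmap : (Algebra.adjoin K t').map A.val = Algebra.adjoin K t := by
    rw [AlgHom.map_adjoin]
    congr 1
    refine Set.image_preimage_eq_of_subset ?_
    intro x hx
    exact ⟨⟨x, ht hx⟩, rfl⟩
  have hmem : ∀ x : Algebra.adjoin K t', ((x : A) : F) ∈ Algebra.adjoin K t := by
    intro x
    rw [← hmap]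
    exact ⟨x, x.2, rfl⟩
  let φ : Algebra.adjoin K t' →ₐ[K] Algebra.adjoin K t :=
    (A.val.comp (Algebra.adjoin K t').val).codRestrict (Algebra.adjoin K t) hmem
  have hφ : Function.Bijective φ := by
    constructor
    · intro a b hab
      have h' := congrArg (fun z : Algebra.adjoin K t => (z : F)) hab
      exact Subtype.ext (Subtype.ext h')
    · intro y
      have hy : (y : F) ∈ (Algebra.adjoin K t').map A.val := by rw [hmap]; exact y.2
      obtain ⟨x, hx, hxy⟩ := hy
      exact ⟨⟨x, hx⟩, Subtype.ext hxy⟩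
  exact ⟨AlgEquiv.ofBijective φ hφ, fun x => rfl⟩

/-- If every element of `s` is algebraic over `K[t]`, then `trdeg_K K[s] ≤ #t`. [folklore] -/
theorem trdeg_adjoin_le_of_forall_isAlgebraic {s t : Set F}
    (h : ∀ x ∈ s, IsAlgebraic (Algebra.adjoin K t) x) :
    Algebra.trdeg K (Algebra.adjoin K s) ≤ #t := by
  set A : Subalgebra K F := Algebra.adjoin K (s ∪ t) with hA
  -- `K[s] ↪ K[s ∪ t]`
  have h1 : Algebra.trdeg K (Algebra.adjoin K s) ≤ Algebra.trdeg K A :=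
    trdeg_le_of_injective (Subalgebra.inclusion (Algebra.adjoin_mono Set.subset_union_left))
      (Subalgebra.inclusion_injective _)
  refine h1.trans ?_
  -- `K[s ∪ t]` is algebraic over its subalgebra generated by `t`
  set t' : Set A := ((↑) : A → F) ⁻¹' t with ht'
  obtain ⟨e, he⟩ := exists_algEquiv_adjoin_preimage (K := K) A
    (t := t) (fun x hx => Algebra.subset_adjoin (Or.inr hx))
  haveI : Algebra.IsAlgebraic (Algebra.adjoin K t') A := by
    refine ⟨fun a => ?_⟩
    have ha : IsAlgebraic (Algebra.adjoin K (s ∪ t)) (a : F) := isAlgebraic_algebraMap a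
    have ha' : IsAlgebraic (Algebra.adjoin K t) (a : F) :=
      ha.adjoin_of_forall_isAlgebraic fun x hx => h x (by
        rcases hx.1 with hs | ht
        · exact hs
        · exact absurd ht hx.2)
    refine ha'.of_ringHom_of_comp_eq (f := (e : Algebra.adjoin K t' →+* Algebra.adjoin K t))
      (g := (A.val : A →+* F)) e.surjective Subtype.val_injective ?_
    ext x
    simp only [RingHom.coe_comp, Function.comp_apply]
    exact he x
  exact (Algebra.IsAlgebraic.trdeg_le_cardinalMk K t').trans
    (Cardinal.mk_preimage_of_injective _ _ Subtype.val_injective)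

/-- `n` elements cannot make a field of transcendence degree `> n` algebraic: if
`n < trdeg_K K[y]` then some `yₖ` is transcendental over `K[z₁, …, zₙ]`. [folklore] -/
theorem exists_transcendental_adjoin_of_lt_trdeg {ι : Type*} (y : ι → F) {n : ℕ}
    (hn : (n : Cardinal) < Algebra.trdeg K (Algebra.adjoin K (Set.range y))) (z : Fin n → F) :
    ∃ k, Transcendental (Algebra.adjoin K (Set.range z)) (y k) := by
  by_contra hcon
  push Not at hcon
  have h : ∀ x ∈ Set.range y, IsAlgebraic (Algebra.adjoin K (Set.range z)) x := by
    rintro _ ⟨k, rfl⟩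
    have := hcon k
    rwa [Transcendental, not_not] at this
  have h1 := trdeg_adjoin_le_of_forall_isAlgebraic (K := K) h
  have h2 : #(Set.range z) ≤ (n : Cardinal) := by
    simpa using Cardinal.mk_range_le_lift (f := z)
  exact (lt_irrefl _) ((hn.trans_le h1).trans_le h2)

/-- **Subadditivity**: `trdeg_K K[s ∪ t] ≤ trdeg_K K[s] + #t`. [folklore] -/
theorem trdeg_adjoin_union_le (s t : Set F) :
    Algebra.trdeg K (Algebra.adjoin K (s ∪ t)) ≤ Algebra.trdeg K (Algebra.adjoin K s) + #t := by
  set A : Subalgebra K F := Algebra.adjoin K s with hA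
  set s' : Set A := ((↑) : A → F) ⁻¹' s with hs'
  obtain ⟨e, he⟩ := exists_algEquiv_adjoin_preimage (K := K) A (t := s)
    (fun x hx => Algebra.subset_adjoin hx)
  -- `A` is (trivially) algebraic over its subalgebra generated by `s`
  haveI : Algebra.IsAlgebraic (Algebra.adjoin K s') A := by
    refine ⟨fun a => ?_⟩
    have ha : IsAlgebraic (Algebra.adjoin K s) (a : F) := isAlgebraic_algebraMap a
    refine ha.of_ringHom_of_comp_eq (f := (e : Algebra.adjoin K s' →+* Algebra.adjoin K s))
      (g := (A.val : A →+* F)) e.surjective Subtype.val_injective ?_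
    ext x
    simp only [RingHom.coe_comp, Function.comp_apply]
    exact he x
  -- a transcendence basis `B ⊆ s'` of `A`
  obtain ⟨B, hBs, hB⟩ := exists_isTranscendenceBasis_subset (R := K) (A := A) s'
  have hcard : #B = Algebra.trdeg K A := hB.cardinalMk_eq_trdeg
  haveI halg : Algebra.IsAlgebraic (Algebra.adjoin K (Set.range ((↑) : B → A))) A := hB.isAlgebraic
  -- everything in `s ∪ t` is algebraic over `K[B ∪ t]` (`B` viewed in `F`)
  set B' : Set F := ((↑) : A → F) '' B with hB'
  obtain ⟨e', he'⟩ := exists_algEquiv_adjoin_preimage (K := K) A (t := B')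
    (by rintro _ ⟨b, hb, rfl⟩; exact b.2)
  have hpre : ((↑) : A → F) ⁻¹' B' = Set.range ((↑) : B → A) := by
    ext a
    simp only [hB', Set.mem_preimage, Set.mem_image, Set.mem_range]
    constructor
    · rintro ⟨b, hb, hba⟩
      exact ⟨⟨b, hb⟩, Subtype.val_injective hba⟩
    · rintro ⟨b, rfl⟩
      exact ⟨b, b.2, rfl⟩
  have key : ∀ x ∈ s ∪ t, IsAlgebraic (Algebra.adjoin K (B' ∪ t)) x := by
    intro x hx
    rcases hx with hxs | hxt
    · -- `x ∈ s ⊆ A` is algebraic over `K[B]`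
      have hxA : IsAlgebraic (Algebra.adjoin K (Set.range ((↑) : B → A))) (⟨x, Algebra.subset_adjoin hxs⟩ : A) :=
        halg.isAlgebraic _
      rw [← hpre] at hxA
      have hxF : IsAlgebraic (Algebra.adjoin K B') x := by
        have := hxA.ringHom_of_comp_eq (f := (e' : Algebra.adjoin K (((↑) : A → F) ⁻¹' B') →+*
            Algebra.adjoin K B')) (g := (A.val : A →+* F)) e'.injective ?_
        · exact this
        · ext z
          simp only [RingHom.coe_comp, Function.comp_apply]
          exact he' z
      exact hxF.tower_top_of_subalgebra_le (Algebra.adjoin_mono Set.subset_union_left)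
    · exact isAlgebraic_algebraMap (⟨x, Algebra.subset_adjoin (Or.inr hxt)⟩ : Algebra.adjoin K (B' ∪ t))
  calc Algebra.trdeg K (Algebra.adjoin K (s ∪ t)) ≤ #(B' ∪ t : Set F) :=
        trdeg_adjoin_le_of_forall_isAlgebraic key
    _ ≤ #B' + #t := Cardinal.mk_union_le _ _
    _ = Algebra.trdeg K A + #t := by
        rw [hB', Cardinal.mk_image_eq Subtype.val_injective, hcard]

/-- `trdeg_K K[x₁, …, x_n] ≤ n`. [folklore] -/
theorem trdeg_adjoin_range_le_card {ι : Type*} [Fintype ι] (x : ι → F) :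
    Algebra.trdeg K (Algebra.adjoin K (Set.range x)) ≤ (Fintype.card ι : Cardinal) := by
  have h1 : Algebra.trdeg K (Algebra.adjoin K (Set.range x)) ≤ #(Set.range x) :=
    trdeg_adjoin_le_of_forall_isAlgebraic fun z hz =>
      isAlgebraic_algebraMap (⟨z, Algebra.subset_adjoin hz⟩ : Algebra.adjoin K (Set.range x))
  refine h1.trans ?_
  have h2 := Cardinal.mk_range_le_lift (f := x)
  rw [Cardinal.mk_fintype ι, Cardinal.lift_natCast] at h2
  exact Cardinal.lift_le.1 (h2.trans_eq (Cardinal.lift_natCast _).symm)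

end Trdeg

/-- The transcendence degree of a generated subalgebra is unchanged under an injective algebra
map: `trdeg_K K[φ(S)] = trdeg_K K[S]`. [folklore] -/
theorem lift_trdeg_adjoin_image_eq {F : Type v} {Ω : Type w} [CommRing F] [Algebra K F]
    [CommRing Ω] [Algebra K Ω] (φ : F →ₐ[K] Ω) (hφ : Function.Injective φ) (S : Set F) :
    Cardinal.lift.{v} (Algebra.trdeg K (Algebra.adjoin K (φ '' S))) =
      Cardinal.lift.{w} (Algebra.trdeg K (Algebra.adjoin K S)) := by
  have e : Algebra.adjoin K S ≃ₐ[K] (Algebra.adjoin K S).map φ :=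
    Subalgebra.equivMapOfInjective _ φ hφ
  have hmap : (Algebra.adjoin K S).map φ = Algebra.adjoin K (φ '' S) := AlgHom.map_adjoin φ S
  have e' : Algebra.adjoin K S ≃ₐ[K] Algebra.adjoin K (φ '' S) :=
    e.trans (Subalgebra.equivOfEq _ _ hmap)
  exact e'.lift_trdeg_eq.symm


/-! ### Density: a polynomial killed by every "good" specialisation vanishes -/

section Density

variable [Infinite K] {F : Type*} [Field F] [Algebra K F] {ι : Type u} [Fintype ι] [DecidableEq ι]

omit [Infinite K] in
/-- One more linear combination in front of an algebraically independent family of linear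
combinations: `(z₀ + t yₖ, z₁, …, zₙ)` is algebraically independent over `K` for all but at most
one `t ∈ K`, provided `yₖ` is transcendental over `K[z₁, …, zₙ]`. [folklore] -/
theorem subsingleton_setOf_not_algebraicIndependent_cons {n : ℕ} {z : Fin n → F}
    (hz : AlgebraicIndependent K z) (z₀ yk : F)
    (hyk : Transcendental (Algebra.adjoin K (Set.range z)) yk) :
    {t : K | ¬ AlgebraicIndependent K
      (Fin.cons (z₀ + algebraMap K F t * yk) z : Fin (n + 1) → F)}.Subsingleton := by
  -- `Fin.cons a z` is independent iff `a` is transcendental over `K[z]`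
  have hiff : ∀ a : F, AlgebraicIndependent K (Fin.cons a z : Fin (n + 1) → F) ↔
      Transcendental (Algebra.adjoin K (Set.range z)) a := by
    intro a
    have e : (fun o : Option (Fin n) => o.elim a z) ∘ finSuccEquiv n =
        (Fin.cons a z : Fin (n + 1) → F) := by
      funext i
      refine Fin.cases ?_ (fun j => ?_) i
      · simp
      · simp
    rw [algebraicIndependent_equiv' (finSuccEquiv n) e, hz.option_iff_transcendental]
  intro t ht t' ht'
  simp only [Set.mem_setOf_eq, hiff] at ht ht'
  rw [Transcendental, not_not] at ht ht'
  by_contra hne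
  apply hyk
  -- `(t - t') yₖ` is algebraic, and `t - t'` is a unit of `K`
  have hsub : IsAlgebraic (Algebra.adjoin K (Set.range z))
      (algebraMap K F (t - t') * yk) := by
    have := ht.sub ht'
    have e : z₀ + algebraMap K F t * yk - (z₀ + algebraMap K F t' * yk) =
        algebraMap K F (t - t') * yk := by rw [map_sub]; ring
    rwa [e] at this
  have hunit : IsAlgebraic (Algebra.adjoin K (Set.range z)) (algebraMap K F ((t - t')⁻¹)) := by
    rw [IsScalarTower.algebraMap_apply K (Algebra.adjoin K (Set.range z)) F]
    exact isAlgebraic_algebraMap _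
  have := hunit.mul hsub
  have e : algebraMap K F ((t - t')⁻¹) * (algebraMap K F (t - t') * yk) = yk := by
    rw [← mul_assoc, ← map_mul, inv_mul_cancel₀ (sub_ne_zero.2 hne), map_one, one_mul]
  rwa [e] at this

/-- **Density.** Let `y : ι → F` generate over `K` a field of transcendence degree `≥ n`. A
polynomial `G(c̲, t̲)` over the infinite field `K` (`c̲ = (c_{ik})_{i < n, k ∈ ι}`) whose
specialisations `G(c, t̲)` vanish for every `c ∈ K^{n × ι}` making the `n` linear combinations
`∑ₖ c_{ik} yₖ` algebraically independent over `K` is zero (the bad `c` are met at most once on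
suitable lines, row by row). [folklore] -/
theorem eq_zero_of_forall_algebraicIndependent_aeval_eq_zero (y : ι → F) :
    ∀ (n : ℕ), (n : Cardinal) ≤ Algebra.trdeg K (Algebra.adjoin K (Set.range y)) →
      ∀ {τ : Type u} (G : MvPolynomial ((Fin n × ι) ⊕ τ) K),
        (∀ c : Fin n × ι → K,
          AlgebraicIndependent K (fun i : Fin n => ∑ k, algebraMap K F (c (i, k)) * y k) →
          aeval (Sum.elim (fun p => C (c p)) X : (Fin n × ι) ⊕ τ → MvPolynomial τ K) G = 0) →
        G = 0 := by
  intro n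
  induction n with
  | zero =>
    intro _ τ G hG
    set c0 : Fin 0 × ι → K := fun _ => 0 with hc0
    have h0 : AlgebraicIndependent K (fun i : Fin 0 => ∑ k, algebraMap K F (c0 (i, k)) * y k) :=
      algebraicIndependent_empty_type_iff.mpr (algebraMap K F).injective
    have h := hG c0 h0
    -- this specialisation is injective (no `c`-variables at all)
    have hcomp : (rename (R := K) (Sum.inr : τ → (Fin 0 × ι) ⊕ τ)).comp
        (aeval (Sum.elim (fun p : Fin 0 × ι => C (c0 p)) X :
          (Fin 0 × ι) ⊕ τ → MvPolynomial τ K)) = AlgHom.id K _ := by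
      refine MvPolynomial.algHom_ext fun v => ?_
      rcases v with p | t
      · exact p.1.elim0
      · simp
    have := congrArg (fun f => f G) hcomp
    simp only [AlgHom.comp_apply, AlgHom.id_apply] at this
    rw [h, map_zero] at this
    exact this.symm
  | succ n ih =>
    intro hn τ G hG
    have hn' : (n : Cardinal) ≤ Algebra.trdeg K (Algebra.adjoin K (Set.range y)) :=
      le_trans (by exact_mod_cast (Nat.le_succ n)) hn
    have hnlt : (n : Cardinal) < Algebra.trdeg K (Algebra.adjoin K (Set.range y)) :=
      lt_of_lt_of_le (by exact_mod_cast (Nat.lt_succ_self n)) hn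
    -- move the first row of `c`-variables among the free variables
    let e : (Fin (n + 1) × ι) ⊕ τ ≃ (Fin n × ι) ⊕ (ι ⊕ τ) :=
      { toFun := Sum.elim
          (fun p => Fin.cases (Sum.inr (Sum.inl p.2)) (fun j => Sum.inl (j, p.2)) p.1)
          (fun t => Sum.inr (Sum.inr t))
        invFun := Sum.elim (fun p => Sum.inl (p.1.succ, p.2))
          (Sum.elim (fun k => Sum.inl (0, k)) (fun t => Sum.inr t))
        left_inv := by
          rintro (⟨i, k⟩ | t)
          · refine Fin.cases ?_ (fun j => ?_) i <;> simp
          · simp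
        right_inv := by
          rintro (⟨j, k⟩ | (k | t)) <;> simp }
    suffices hG' : rename e G = 0 by
      exact rename_injective _ e.injective (by rw [hG', map_zero])
    refine ih hn' (rename e G) fun c' hc' => ?_
    -- it remains to see that `G(v, c', t̲) = 0` for every `v ∈ K^ι`
    refine eq_zero_of_forall_aeval_sumElim_C_eq_zero fun v => ?_
    -- a `yₖ` transcendental over `K[z(c')]`, and the full specialisations `(v + t eₖ, c')`
    obtain ⟨k, hk⟩ := exists_transcendental_adjoin_of_lt_trdeg (K := K) y hnlt
      (fun i : Fin n => ∑ k, algebraMap K F (c' (i, k)) * y k)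
    let cv : K → Fin (n + 1) × ι → K := fun t p =>
      Fin.cases (v p.2 + t * (if p.2 = k then 1 else 0)) (fun j => c' (j, p.2)) p.1
    -- (1) the two-step specialisation is the full specialisation at `cv 0`
    have hrel : aeval (Sum.elim (fun a => C (v a)) X : ι ⊕ τ → MvPolynomial τ K)
        (aeval (Sum.elim (fun p => C (c' p)) X :
            (Fin n × ι) ⊕ (ι ⊕ τ) → MvPolynomial (ι ⊕ τ) K) (rename e G)) =
        aeval (Sum.elim (fun p => C (cv 0 p)) X : (Fin (n + 1) × ι) ⊕ τ → MvPolynomial τ K)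
          G := by
      have hcomp : (aeval (Sum.elim (fun a => C (v a)) X : ι ⊕ τ → MvPolynomial τ K)).comp
          ((aeval (Sum.elim (fun p => C (c' p)) X :
            (Fin n × ι) ⊕ (ι ⊕ τ) → MvPolynomial (ι ⊕ τ) K)).comp (rename e)) =
            aeval (Sum.elim (fun p => C (cv 0 p)) X) := by
        refine MvPolynomial.algHom_ext fun q => ?_
        rcases q with ⟨i, k'⟩ | t
        · refine Fin.cases ?_ (fun j => ?_) i
          · simp [e, cv]
          · simp [e, cv]
        · simp [e]
      have := congrArg (fun f => f G) hcomp
      simpa only [AlgHom.comp_apply] using this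
    rw [hrel]
    -- (2) the line `t ↦ cv t` through `cv 0` in the direction `e_{(0,k)}`
    have hline : ∀ (t : K) (a : Fin (n + 1) × ι), cv 0 a +
        t * Fin.cases (if a.2 = k then (1 : K) else 0) (fun _ => 0) a.1 = cv t a := by
      rintro t ⟨i, k'⟩
      refine Fin.cases ?_ (fun j => ?_) i
      · simp [cv]
      · simp [cv]
    have hz : ∀ t : K, (fun i : Fin (n + 1) => ∑ k', algebraMap K F (cv t (i, k')) * y k') =
        Fin.cons ((∑ k', algebraMap K F (v k') * y k') + algebraMap K F t * y k)
          (fun j : Fin n => ∑ k', algebraMap K F (c' (j, k')) * y k') := by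
      intro t
      funext i
      refine Fin.cases ?_ (fun j => ?_) i
      · simp only [cv, Fin.cases_zero, Fin.cons_zero, map_add, add_mul,
          Finset.sum_add_distrib, mul_ite, mul_one, mul_zero]
        congr 1
        rw [Finset.sum_eq_single k]
        · simp
        · intro b _ hb; simp [hb]
        · intro h; exact absurd (Finset.mem_univ k) h
      · simp [cv]
    have hsub := subsingleton_setOf_not_algebraicIndependent_cons (K := K) hc'
      (∑ k', algebraMap K F (v k') * y k') (y k) hk
    refine aeval_sumElim_C_eq_zero_of_infinite G (cv 0)
      (fun a => Fin.cases (if a.2 = k then (1 : K) else 0) (fun _ => 0) a.1) ?_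
    refine Set.Infinite.mono ?_ (hsub.finite.infinite_compl)
    intro t ht
    simp only [Set.mem_compl_iff, Set.mem_setOf_eq, not_not] at ht
    simp only [Set.mem_setOf_eq, hline t]
    exact hG (cv t) (by rw [hz t]; exact ht)

end Density

/-! ### The theorem -/

section Main

variable [Infinite K] {F Ω : Type*} [Field F] [Field Ω] [Algebra K F] [Algebra F Ω] [Algebra K Ω]
  [IsScalarTower K F Ω] {s : ℕ}

/-- **Generic linear forms are algebraically independent** (index type in `Type`; see
`algebraicIndependent_sumElim_genericLinearForms` for the general statement). [folklore] -/
theorem algebraicIndependent_sumElim_genericLinearForms₀ {ι : Type} [Fintype ι]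
    (y : ι → F) (u : Fin s × ι → Ω) (hu : AlgebraicIndependent F u)
    (hs : (s : Cardinal) ≤ Algebra.trdeg K (Algebra.adjoin K (Set.range y))) :
    AlgebraicIndependent K (Sum.elim u (fun i => ∑ k, algebraMap F Ω (y k) * u (i, k))) := by
  classical
  rw [algebraicIndependent_iff_injective_aeval, injective_iff_map_eq_zero]
  intro P hP
  set ηv : (Fin s × ι) ⊕ Fin s → MvPolynomial ((Fin s × ι) ⊕ (Fin s ⊕ Fin s)) K :=
    Sum.elim (fun p => X (Sum.inl p) * X (Sum.inr (Sum.inl p.1)))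
      (fun i => X (Sum.inr (Sum.inl i)) * X (Sum.inr (Sum.inr i))) with hηv
  set θv : (Fin s × ι) ⊕ (Fin s ⊕ Fin s) → MvPolynomial ((Fin s × ι) ⊕ Fin s) K :=
    Sum.elim (fun p => X (Sum.inl p)) (Sum.elim (fun _ => 1) (fun i => X (Sum.inr i))) with hθv
  -- the universal specialisation `η P` of `P` vanishes, by density and specialisation
  have hη : aeval ηv P = 0 :=
    eq_zero_of_forall_algebraicIndependent_aeval_eq_zero y s hs _ fun c hc =>
      aeval_genericSpec_eq_zero y u hu hP c hc
  -- and `η` has a left inverse (`T ↦ 1`, `Z ↦ W`, `C ↦ U`)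
  have hcomp : (aeval θv).comp (aeval ηv) = AlgHom.id K _ := by
    refine MvPolynomial.algHom_ext fun v => ?_
    rcases v with p | i <;> simp [ηv, θv]
  have := congrArg (fun f => f P) hcomp
  simp only [AlgHom.comp_apply, AlgHom.id_apply] at this
  rw [hη, map_zero] at this
  exact this.symm

/-- **Generic linear forms in elements of a field extension are algebraically independent.**
Let `K ⊆ F ⊆ Ω` be fields, `K` infinite, `y : ι → F` a finite family generating over `K` a
subalgebra of transcendence degree at least `s`, and `u = (u_{ik})_{i < s, k ∈ ι}` elements of `Ω`
algebraically independent over `F`. Then the `s` generic linear combinations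
`wᵢ = ∑ₖ yₖ u_{ik}` together with all the `u_{ik}` are algebraically independent over `K`
(equivalently: `w₁, …, w_s` are algebraically independent over `K(u)`). This is the algebraic
content of "a generic linear subspace of codimension `s ≤ dim V` meets the variety `V`
properly" (the generic fibre of a generic linear projection of `V` to `𝔸ˢ` is dominant).
[folklore] -/
theorem algebraicIndependent_sumElim_genericLinearForms {ι : Type*} [Fintype ι]
    (y : ι → F) (u : Fin s × ι → Ω) (hu : AlgebraicIndependent F u)
    (hs : (s : Cardinal) ≤ Algebra.trdeg K (Algebra.adjoin K (Set.range y))) :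
    AlgebraicIndependent K (Sum.elim u (fun i => ∑ k, algebraMap F Ω (y k) * u (i, k))) := by
  classical
  -- transport to the index type `Fin (card ι)`
  set e := Fintype.equivFin ι with he
  set y' : Fin (Fintype.card ι) → F := y ∘ e.symm with hy'
  set u' : Fin s × Fin (Fintype.card ι) → Ω := fun p => u (p.1, e.symm p.2) with hu'
  have hrange : Set.range y' = Set.range y := by
    rw [hy', Set.range_comp, Equiv.range_eq_univ, Set.image_univ]
  have hu'' : AlgebraicIndependent F u' := by
    have : u' = u ∘ (Equiv.prodCongr (Equiv.refl (Fin s)) e.symm) := by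
      funext ⟨i, k⟩; rfl
    rw [this]
    exact (algebraicIndependent_equiv _).mpr hu
  have h := algebraicIndependent_sumElim_genericLinearForms₀ (K := K) y' u' hu''
    (by rwa [hrange])
  have hw : (fun i : Fin s => ∑ k, algebraMap F Ω (y' k) * u' (i, k)) =
      fun i => ∑ k, algebraMap F Ω (y k) * u (i, k) := by
    funext i
    exact Equiv.sum_comp e.symm (fun k => algebraMap F Ω (y k) * u (i, k))
  rw [hw] at h
  have key : Sum.elim u' (fun i => ∑ k, algebraMap F Ω (y k) * u (i, k)) =
      Sum.elim u (fun i => ∑ k, algebraMap F Ω (y k) * u (i, k)) ∘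
        (Equiv.sumCongr (Equiv.prodCongr (Equiv.refl (Fin s)) e.symm) (Equiv.refl (Fin s))) := by
    funext v
    rcases v with ⟨i, k⟩ | i <;> rfl
  rw [key] at h
  exact (algebraicIndependent_equiv _).mp h

end Main

end Literature.RingTheory.NoetherNormalization
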